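import Summits.HodgeConjecture.HodgeConjecture.Theorems.F0P3cStCharTSUpTrCover          -- (H3e) FILE 1 (this seat): `image_conjFamily_eq`, `measurableSet_cartanSet` (generic `(G, R, T)`)
import Summits.HodgeConjecture.HodgeConjecture.Theorems.F0P3cStCharTSWeylCartanFibre     -- ★ (E1a) generic fibre kit: `subsingleton_preimage_inter_prod`, `exists_isOpen_wFree_nhds`, `wFree_mono`
import Summits.HodgeConjecture.HodgeConjecture.Theorems.F0P3cStCharTSWeylHypJacobian     -- ★ p849811 §1 `restrict_eq_restrict_of_forall_nhds` (generic)
import HarnessLib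

/-!
# F0 · P3c · ROAD «UP-TR» (H3e) «JAC-BY-SHAPE»: the LOCAL TUBE JACOBIAN at a «Cartan» subgroup ⇒ the WEIGHTED Weyl integration formula on its regular set — GENERIC in
# `(G, R, T)`, and at the endoscopic group `H_v = U(Φ₂)(L⁺_v) × U(Φ₁)(L⁺_v)` with `R = {G-regular}` (Harish-Chandra 1970 Lemmas 20, 22, 42; Rogawski 1990 §12.5 pp. 182–183)

Cell `pub/hodgecm-mathlib`, crux H413 = `stmt-HodgeConjecture-24833` (lane `--supports`, helper; count-neutral); seat F0P3a-p02 (g24); ROAD «UP-TR» (LEAD T14-21, holder F0P3-p02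
(g23), road file `ROAD-UP-TR.v1` f07fd8df) brick **(H3e) JAC-BY-SHAPE-H** — the (S-jac) letter of the (H5) WIF-H assembler (F0P3a-p05 (g24), 18:17:04Z).  THEOREMS ONLY; sorry-free;
no definition ∕ instance ∕ notation ∕ named fact; ★-only imports; axioms TRIO.

THE POINT.  ★ (E1b) `F0P3cStCharTSWeylCartanJacobian` proves, for `G = U(Φ₃)(L⁺_v)`, `R = {regular semisimple}` and a Cartan `T = Z(γ₀)`: IF the Haar measure of thin conjugation
tubes `Φ(A₀ × V)` over `W`-free regular patches `V ⊆ T` is `μ₀(A₀) · ∫⁻_V D dtm` (the LOCAL TUBE JACOBIAN socket `hJacLoc`, [HarishChandra1970 L. 20 ∕ L. 22]), THEN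
`[N(T):T] · ∫⁻_{G_T} f dν = ∫⁻_{T ∩ R} D(t) · ∫⁻_{G⧸T} f(Φ(q,t)) dμ₀ dtm` and its Bochner form.  Its proof uses about `(G, R, T)` only the five engine letters of ★
`Literature.MeasureTheory.Group.ConjugationWeylVanishing` (`T` closed abelian, `Z(t) = T` on `T ∩ R`, `R` Borel and conjugation-invariant, `[N(T):T] ≠ 0`).  The `H`-side Weyl
integration formula of the UP-TRANSFER identity [Rogawski1990 §12.5 p. 183, L. 12.5.1] needs the same statement on `H_v = U(Φ₂)(L⁺_v) × U(Φ₁)(L⁺_v)` with `R = {IsLocalGRegular L v}`.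
This file re-types ★ (E1b) ONCE in the engine letters (§1: `∫⁻` form; §2: Bochner form — proofs verbatim ★ (E1b): fibre-count pull-back ★ `exists_measure_apply_eq_lintegral_count_fibre`,
Weil factorisation ★ `exists_radial_prod_eq_fibreCount_conjFamily`, single-point fibres over `W`-free patches ★ (E1a) `subsingleton_preimage_inter_prod`, `W`-free neighbourhoods ★ (E1a)
`exists_isOpen_wFree_nhds`, local-to-global ★ `restrict_eq_restrict_of_forall_nhds`, Bochner transport ★ `integrable_and_integral_eq_smul_of_lintegral_radial`) and instantiates it at
`H_v` in §3 with the (H3a)(H3b) facts BY SHAPE and the weight `D : ↥T → ℝ≥0` ABSTRACT (the road's `dh²`, or whatever the (H4s)∕(H4c) socket letters carry, plugs in unchanged).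

§1 `lintegral_cartanSet_eq_of_tubeJacobian_local` (generic `∫⁻`) · §2 `integral_cartanSet_eq_of_tubeJacobian_local` (generic Bochner) · §3 `H_v` heads = (S-jac) in the (H5) consumer's tokens.
HONEST LABEL: count-neutral; CONDITIONAL on the socket `hJacLoc` by shape (the (H4s)∕(H4c) bricks of the road pay it); closes no organ; block consequents 11 → 10 → 9 only at the rider
editions; organs 2 = 2; h413 registry untouched.  HC_CM is proved only modulo the printed citations (2 remaining named inputs: hLiu418 = `stmt-HodgeConjecture-24832`, h413 =
`stmt-HodgeConjecture-24833`) until rung 0 closes.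

## References
* [Rogawski1990] J. D. Rogawski, *Automorphic Representations of Unitary Groups in Three Variables*, Ann. of Math. Stud. 123 (1990), §12.5 pp. 182–183, Lemma 12.5.1.
* [HarishChandra1970] Harish-Chandra (notes by G. van Dijk), *Harmonic analysis on reductive p-adic groups*, LNM 162 (1970), Part V §3 Lemma 20, §4 Lemma 22, Lemma 42.
* [Weil1965] A. Weil, *Sur la formule de Siegel…*, Acta Math. 113 (1965), n° 49 Lemme 22 (p. 70) · [Federer1969] H. Federer, *Geometric Measure Theory* (1969), §2.10.10.
-/

set_option autoImplicit false
-- the mandated namespace has the single-problem summit's repeated segment (`HodgeConjecture.HodgeConjecture`)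
set_option linter.dupNamespace false

noncomputable section

open MeasureTheory Measure Set Filter Topology Function NumberField IsDedekindDomain
open Literature.MeasureTheory.Group
open Literature.NumberTheory.Automorphic Literature.NumberTheory.Rogawski1990
open Summit.HodgeConjecture.HodgeConjecture.Cruxes.H413.F0P3cStCharTSWeylHypMeasure
open Summit.HodgeConjecture.HodgeConjecture.Cruxes.H413.F0P3cStCharTSWeylHypJacobian
open Summit.HodgeConjecture.HodgeConjecture.Cruxes.H413.F0P3cStCharTSWeylCartanFibre
open Summit.HodgeConjecture.HodgeConjecture.Cruxes.H413.F0P3cStCharTSUpTrCover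
open scoped ENNReal NNReal MatrixGroups Pointwise

namespace Summit.HodgeConjecture.HodgeConjecture.Cruxes.H413.F0P3cStCharTSUpTrJacobian

/-! ## §1 Generic: local tube Jacobian at `T` ⇒ the weighted radial formula on the `T`-regular set -/

section Generic

variable {G : Type*} [Group G] [TopologicalSpace G] [IsTopologicalGroup G] [LocallyCompactSpace G]
  [SecondCountableTopology G] [T2Space G] [MeasurableSpace G] [BorelSpace G]
  {R : Set G} (hRm : MeasurableSet R) (hRc : ∀ g x : G, x ∈ R → g * x * g⁻¹ ∈ R)
  {T : Subgroup G} (hT : IsClosed (T : Set G)) (hTc : ∀ a ∈ T, ∀ b ∈ T, a * b = b * a)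
  (hRT : ∀ t : ↥T, (t : G) ∈ R → Subgroup.centralizer ({(t : G)} : Set G) = T)
  (hW : (T.subgroupOf (Subgroup.normalizer (T : Set G))).index ≠ 0)
  (Φ : (G ⧸ T) × ↥T → G) (hΦ : ∀ (x : G) (t : ↥T), Φ (QuotientGroup.mk x, t) = x * t * x⁻¹)
  [MeasurableSpace (G ⧸ T)] [BorelSpace (G ⧸ T)]
  (ν : Measure G) [ν.IsHaarMeasure] [ν.IsMulRightInvariant]
  (tm : Measure ↥T) [tm.IsMulLeftInvariant] [IsFiniteMeasureOnCompacts tm] [tm.IsOpenPosMeasure] [tm.IsInvInvariant]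
  (D : ↥T → ℝ≥0) (hD : Measurable D)

set_option maxHeartbeats 1600000 in
-- instance-term unification for `quotientMeasure` with its σ-algebra arguments (as ★ p849811 ∕ ★ p851645 ∕ ★ (E1b))
include hRm hRc hTc hRT hW hΦ hD in
/-- **LOCAL TUBE JACOBIAN AT A «CARTAN» SUBGROUP ⇒ WEIGHTED WEYL INTEGRATION FORMULA ON ITS REGULAR SET (generic).**  `G` locally compact second-countable Hausdorff, `ν` a Haar
measure; `R ⊆ G` Borel and conjugation-invariant; `T ≤ G` closed abelian with `Z(t) = T` for `t ∈ T ∩ R` and `[N(T):T] ≠ 0`; `Φ(xT, t) = x t x⁻¹`; `tm` a Haar measure on `T`, `μ₀ = ν∕tm`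
(★ `quotientMeasure`); `D : T → ℝ≥0` measurable.  IF every `t₀ ∈ T ∩ R` has an open `U ∋ t₀` in `T` and a measurable `A₀ ⊆ G⧸T` with `0 < μ₀ A₀ < ∞` such that for every measurable,
`R`-valued, `W`-FREE `V ⊆ U` (`∀ n ∉ T, ∀ t t′ ∈ V, t′ ≠ n t n⁻¹`) `ν(Φ(A₀ × V)) = μ₀(A₀) · ∫⁻_V D dtm` (`hJacLoc`, [HarishChandra1970, L. 20, L. 22]) THEN for every Borel `f ≥ 0`
**`[N(T):T] · ∫⁻_{G_T} f dν = ∫⁻_{t ∈ T ∩ R} D(t) · ∫⁻_{G⧸T} f(Φ(q,t)) dμ₀ dtm`**, `G_T = {g t g⁻¹ | t ∈ T ∩ R}`.  (★ (E1b) is the case `G = U(Φ₃)(L⁺_v)`, `R = {regular}`; proof verbatim.)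
[cite: Rogawski1990, §12.5 p. 182] [cite: HarishChandra1970, Lemma 20; Lemma 22; Lemma 42] [cite: Weil1965, n° 49 Lemme 22 (p. 70)] [cite: Federer1969, §2.10.10] -/
theorem lintegral_cartanSet_eq_of_tubeJacobian_local
    (hJacLoc : ∀ t₀ : ↥T, (t₀ : G) ∈ R →
      ∃ U : Set ↥T, IsOpen U ∧ t₀ ∈ U ∧
        ∃ A₀ : Set (G ⧸ T), MeasurableSet A₀ ∧ (quotientMeasure T tm hT ν) A₀ ≠ 0 ∧ (quotientMeasure T tm hT ν) A₀ ≠ ∞ ∧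
          ∀ V : Set ↥T, MeasurableSet V → V ⊆ U → (∀ t ∈ V, (t : G) ∈ R) →
            (∀ n : G, n ∉ T → ∀ t ∈ V, ∀ t' ∈ V, ((t' : ↥T) : G) ≠ n * t * n⁻¹) →
              ν (Φ '' (A₀ ×ˢ V)) = (quotientMeasure T tm hT ν) A₀ * ∫⁻ t in V, (D t : ℝ≥0∞) ∂tm) :
    ∀ f : G → ℝ≥0∞, Measurable f →
      ((T.subgroupOf (Subgroup.normalizer (T : Set G))).index : ℝ≥0∞) *
          ∫⁻ y in {x | ∃ g t : G, t ∈ T ∧ t ∈ R ∧ g * t * g⁻¹ = x}, f y ∂ν =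
        ∫⁻ t in {t : ↥T | (t : G) ∈ R}, (D t : ℝ≥0∞) * ∫⁻ q, f (Φ (q, t)) ∂(quotientMeasure T tm hT ν) ∂tm := by
  classical
  haveI : IsClosed (T : Set G) := hT
  -- §a topology ∕ measurability: Polish product, `Φ` continuous, the `R`-part `D₀` of `G⧸T × T` Borel, `G_T = Φ(D₀)` Borel
  haveI : PolishSpace ((G ⧸ T) × ↥T) := polishSpace_quotient_prod_subgroup T hT
  have hΦc : Continuous Φ := (continuous_conjFamily_and_smul T Φ hΦ).1
  haveI : SecondCountableTopology ↥T := TopologicalSpace.Subtype.secondCountableTopology _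
  haveI : BorelSpace ((G ⧸ T) × ↥T) := Prod.borelSpace
  haveI : T1Space (G ⧸ T) := QuotientGroup.instT1Space
  haveI : MeasurableSingletonClass (G ⧸ T) := ⟨fun x => isClosed_singleton.measurableSet⟩
  haveI : MeasurableSingletonClass ↥T := ⟨fun x => isClosed_singleton.measurableSet⟩
  haveI : MeasurableSingletonClass ((G ⧸ T) × ↥T) := Prod.instMeasurableSingletonClass
  haveI : SecondCountableTopology (G ⧸ T) := (QuotientGroup.isQuotientMap_mk _).secondCountableTopology QuotientGroup.isOpenMap_coe
  haveI : LocallyCompactSpace (G ⧸ T) := QuotientGroup.instLocallyCompactSpace _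
  haveI : SigmaCompactSpace (G ⧸ T) := sigmaCompactSpace_of_locallyCompact_secondCountable
  haveI : SigmaFinite (quotientMeasure T tm hT ν) := SigmaFinite.of_isFiniteMeasureOnCompacts _
  have hSm : MeasurableSet {t : ↥T | (t : G) ∈ R} := measurable_subtype_coe hRm
  have hDm : MeasurableSet {p : (G ⧸ T) × ↥T | ((p.2 : ↥T) : G) ∈ R} :=
    hRm.preimage (continuous_subtype_val.measurable.comp measurable_snd)
  have hinj := locallyInjOn_conjFamily T hT hTc Φ hΦ R hRT hW
  have hΩeq := image_conjFamily_eq (R := R) Φ hΦ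
  have hΩm : MeasurableSet {x | ∃ g t : G, t ∈ T ∧ t ∈ R ∧ g * t * g⁻¹ = x} := measurableSet_cartanSet hT hTc hRm hRT hW
  -- §b the fibre-count pull-back `μ` of `ν` and its Weil factorisation `μ = μ₀ ⊗ σ`; the radial formula for this `σ`
  obtain ⟨μ, hμ⟩ := exists_measure_apply_eq_lintegral_count_fibre hDm hΦc hinj ν
  have hwc : ∀ y ∈ Φ '' {p : (G ⧸ T) × ↥T | ((p.2 : ↥T) : G) ∈ R},
      Measure.count (Φ ⁻¹' {y} ∩ {p : (G ⧸ T) × ↥T | ((p.2 : ↥T) : G) ∈ R}) = ((T.subgroupOf (Subgroup.normalizer (T : Set G))).index : ℝ≥0∞) :=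
    fun y hy => count_fibre_conjFamily_eq T hTc Φ hΦ R hRT hRc hW hy
  obtain ⟨σ, hσfin, hσsf, hσcar, hprod⟩ := exists_radial_prod_eq_fibreCount_conjFamily T hT hTc ν Φ hΦ R hRm hRT hRc hW tm hμ
  haveI := hσsf
  have hformula : ∀ f : G → ℝ≥0∞, Measurable f →
      ((T.subgroupOf (Subgroup.normalizer (T : Set G))).index : ℝ≥0∞) * ∫⁻ y in {x | ∃ g t : G, t ∈ T ∧ t ∈ R ∧ g * t * g⁻¹ = x}, f y ∂ν =
        ∫⁻ t, ∫⁻ q, f (Φ (q, t)) ∂(quotientMeasure T tm hT ν) ∂σ := by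
    intro f hf
    have h1 := lintegral_comp_eq_mul_setLIntegral_image hDm hΦc hinj hμ hwc hf
    rw [hΩeq, ← hprod, lintegral_prod_symm (fun z : (G ⧸ T) × ↥T => f (Φ z)) (hf.comp hΦc.measurable).aemeasurable] at h1
    exact h1.symm
  -- §c evaluation on tubes over `W`-free `R`-patches `V`: `σ V = ∫⁻_V D dtm`
  have htube : ∀ A₀ : Set (G ⧸ T), MeasurableSet A₀ → (quotientMeasure T tm hT ν) A₀ ≠ 0 → (quotientMeasure T tm hT ν) A₀ ≠ ∞ →
      ∀ V : Set ↥T, MeasurableSet V → (∀ t ∈ V, (t : G) ∈ R) →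
      (∀ n : G, n ∉ T → ∀ t ∈ V, ∀ t' ∈ V, ((t' : ↥T) : G) ≠ n * t * n⁻¹) →
      ν (Φ '' (A₀ ×ˢ V)) = (quotientMeasure T tm hT ν) A₀ * ∫⁻ t in V, (D t : ℝ≥0∞) ∂tm → σ V = ∫⁻ t in V, (D t : ℝ≥0∞) ∂tm := by
    intro A₀ hA₀m hA₀0 hA₀top V hVm hVreg hVfree h3
    have hE : MeasurableSet (A₀ ×ˢ V) := hA₀m.prod hVm
    have hEsub : A₀ ×ˢ V ⊆ {p : (G ⧸ T) × ↥T | ((p.2 : ↥T) : G) ∈ R} := fun p hp => hVreg p.2 hp.2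
    have hEim : MeasurableSet (Φ '' (A₀ ×ˢ V)) := by
      rw [← inter_eq_left.2 hEsub]; exact measurableSet_image_inter_of_locallyInjOn hDm hΦc hinj hE
    -- every fibre meets `A₀ × V` at most once (★ (E1a))
    have hsub : ∀ y, (Φ ⁻¹' {y} ∩ (A₀ ×ˢ V ∩ {p : (G ⧸ T) × ↥T | ((p.2 : ↥T) : G) ∈ R})).Subsingleton :=
      fun y => (subsingleton_preimage_inter_prod T hTc Φ hΦ hVfree A₀ y).anti (inter_subset_inter_right _ inter_subset_left)
    have hcount : ∀ y, Measure.count (Φ ⁻¹' {y} ∩ (A₀ ×ˢ V ∩ {p : (G ⧸ T) × ↥T | ((p.2 : ↥T) : G) ∈ R})) = (Φ '' (A₀ ×ˢ V)).indicator 1 y := by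
      intro y
      by_cases hy : y ∈ Φ '' (A₀ ×ˢ V)
      · obtain ⟨p, hp, rfl⟩ := hy
        have hmem : p ∈ Φ ⁻¹' {Φ p} ∩ (A₀ ×ˢ V ∩ {p : (G ⧸ T) × ↥T | ((p.2 : ↥T) : G) ∈ R}) := ⟨rfl, hp, hEsub hp⟩
        rw [(hsub (Φ p)).eq_singleton_of_mem hmem, Measure.count_singleton, indicator_of_mem (mem_image_of_mem Φ hp), Pi.one_apply]
      · have hempty : Φ ⁻¹' {y} ∩ (A₀ ×ˢ V ∩ {p : (G ⧸ T) × ↥T | ((p.2 : ↥T) : G) ∈ R}) = ∅ :=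
          eq_empty_of_forall_notMem fun p hp => hy ⟨p, hp.2.1, hp.1⟩
        rw [hempty, measure_empty, indicator_of_notMem hy]
    have hμE : μ (A₀ ×ˢ V) = ν (Φ '' (A₀ ×ˢ V)) := by
      rw [hμ _ hE, lintegral_congr fun y => hcount y, lintegral_indicator_one hEim]
    have hμE' : μ (A₀ ×ˢ V) = (quotientMeasure T tm hT ν) A₀ * σ V := by
      rw [← hprod, Measure.prod_prod]
    rw [← hμE, hμE'] at h3
    exact (ENNReal.mul_right_inj hA₀0 hA₀top).1 h3
  -- §d every `t₀ ∈ T ∩ R` has a `W`-free open neighbourhood (★ (E1a), finite Weyl group); on it `σ = D · tm`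
  have hnbhd : ∀ t₀ ∈ {t : ↥T | (t : G) ∈ R}, ∃ U : Set ↥T, IsOpen U ∧ t₀ ∈ U ∧
      σ.restrict (U ∩ {t : ↥T | (t : G) ∈ R}) = (tm.withDensity fun t => (D t : ℝ≥0∞)).restrict (U ∩ {t : ↥T | (t : G) ∈ R}) := by
    intro t₀ ht₀
    obtain ⟨U, hUo, ht₀U, A₀, hA₀m, hA₀0, hA₀top, hJ'⟩ := hJacLoc t₀ ht₀
    obtain ⟨U', hU'o, ht₀U', hfree⟩ := exists_isOpen_wFree_nhds T hTc R hRT hW t₀ ht₀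
    refine ⟨U' ∩ U, hU'o.inter hUo, ⟨ht₀U', ht₀U⟩, ?_⟩
    ext B hB
    have hVm : MeasurableSet (B ∩ (U' ∩ U ∩ {t : ↥T | (t : G) ∈ R})) := hB.inter ((hU'o.inter hUo).measurableSet.inter hSm)
    have hVfree : ∀ n : G, n ∉ T → ∀ t ∈ B ∩ (U' ∩ U ∩ {t : ↥T | (t : G) ∈ R}), ∀ t' ∈ B ∩ (U' ∩ U ∩ {t : ↥T | (t : G) ∈ R}),
        ((t' : ↥T) : G) ≠ n * t * n⁻¹ :=
      wFree_mono T (U := U' ∩ {t : ↥T | (t : G) ∈ R}) (fun t ht => ⟨ht.2.1.1, ht.2.2⟩) hfree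
    rw [Measure.restrict_apply hB, Measure.restrict_apply hB, withDensity_apply _ hVm]
    exact htube A₀ hA₀m hA₀0 hA₀top _ hVm (fun t ht => ht.2.2) hVfree
      (hJ' _ hVm (fun t ht => ht.2.1.2) (fun t ht => ht.2.2) hVfree)
  have hident := restrict_eq_restrict_of_forall_nhds hnbhd
  -- §e assembly
  intro f hf
  have hσS : σ = σ.restrict {t : ↥T | (t : G) ∈ R} := by
    refine (Measure.restrict_eq_self_of_ae_mem ?_).symm
    rw [ae_iff]
    simpa only [mem_setOf_eq] using hσcar
  have hOm : Measurable fun t : ↥T => ∫⁻ q, f (Φ (q, t)) ∂(quotientMeasure T tm hT ν) :=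
    Measurable.lintegral_prod_left' (μ := (quotientMeasure T tm hT ν)) (hf.comp hΦc.measurable)
  rw [hformula f hf, hσS, hident, restrict_withDensity hSm, lintegral_withDensity_eq_lintegral_mul _ hD.coe_nnreal_ennreal hOm]
  rfl

/-! ## §2 Generic: the Bochner form -/

set_option maxHeartbeats 1600000 in
-- instance-term unification for `quotientMeasure` with its σ-algebra arguments, as above
include hRm hRc hTc hRT hW hΦ hD in
/-- **The Bochner ∕ vector-valued form of §1 (generic)**: under the same socket `hJacLoc`, for every `g : G → ℂ` that is `ν`-integrable on `G_T`, `(t, q) ↦ g(Φ(q, t))` is integrable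
for `(D · tm|_{T ∩ R}) ⊗ μ₀` and **`∫_{t ∈ T ∩ R} D(t) • (∫_{G⧸T} g(Φ(q, t)) dμ₀) dtm = [N(T):T] • ∫_{G_T} g dν`** (★ `integrable_and_integral_eq_smul_of_lintegral_radial` along §1, then
`integral_withDensity_eq_integral_smul`; proof verbatim ★ (E1b) §2). [cite: Rogawski1990, §12.5 p. 182] [cite: HarishChandra1970, Lemma 42] [cite: Federer1969, §2.10.10] -/
theorem integral_cartanSet_eq_of_tubeJacobian_local
    (hJacLoc : ∀ t₀ : ↥T, (t₀ : G) ∈ R →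
      ∃ U : Set ↥T, IsOpen U ∧ t₀ ∈ U ∧
        ∃ A₀ : Set (G ⧸ T), MeasurableSet A₀ ∧ (quotientMeasure T tm hT ν) A₀ ≠ 0 ∧ (quotientMeasure T tm hT ν) A₀ ≠ ∞ ∧
          ∀ V : Set ↥T, MeasurableSet V → V ⊆ U → (∀ t ∈ V, (t : G) ∈ R) →
            (∀ n : G, n ∉ T → ∀ t ∈ V, ∀ t' ∈ V, ((t' : ↥T) : G) ≠ n * t * n⁻¹) →
              ν (Φ '' (A₀ ×ˢ V)) = (quotientMeasure T tm hT ν) A₀ * ∫⁻ t in V, (D t : ℝ≥0∞) ∂tm)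
    (g : G → ℂ) (hg : IntegrableOn g {x | ∃ g t : G, t ∈ T ∧ t ∈ R ∧ g * t * g⁻¹ = x} ν) :
    Integrable (fun p : ↥T × (G ⧸ T) => g (Φ (p.2, p.1)))
        (((tm.restrict {t : ↥T | (t : G) ∈ R}).withDensity fun t => (D t : ℝ≥0∞)).prod (quotientMeasure T tm hT ν)) ∧
      ∫ t in {t : ↥T | (t : G) ∈ R}, (D t : ℝ) • ∫ q, g (Φ (q, t)) ∂(quotientMeasure T tm hT ν) ∂tm =
        ((T.subgroupOf (Subgroup.normalizer (T : Set G))).index : ℝ) • ∫ y in {x | ∃ g t : G, t ∈ T ∧ t ∈ R ∧ g * t * g⁻¹ = x}, g y ∂ν := by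
  have hmain := lintegral_cartanSet_eq_of_tubeJacobian_local hRm hRc hT hTc hRT hW Φ hΦ ν tm D hD hJacLoc
  haveI : IsClosed (T : Set G) := hT
  have hSm : MeasurableSet {t : ↥T | (t : G) ∈ R} := measurable_subtype_coe hRm
  haveI : SecondCountableTopology ↥T := TopologicalSpace.Subtype.secondCountableTopology _
  haveI : BorelSpace ((G ⧸ T) × ↥T) := Prod.borelSpace
  haveI : SecondCountableTopology (G ⧸ T) := (QuotientGroup.isQuotientMap_mk _).secondCountableTopology QuotientGroup.isOpenMap_coe
  haveI : LocallyCompactSpace (G ⧸ T) := QuotientGroup.instLocallyCompactSpace _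
  haveI : SigmaCompactSpace (G ⧸ T) := sigmaCompactSpace_of_locallyCompact_secondCountable
  haveI : SigmaFinite (quotientMeasure T tm hT ν) := SigmaFinite.of_isFiniteMeasureOnCompacts _
  haveI : LocallyCompactSpace ↥T := hT.isClosedEmbedding_subtypeVal.locallyCompactSpace
  haveI : SigmaCompactSpace ↥T := sigmaCompactSpace_of_locallyCompact_secondCountable
  haveI : SigmaFinite tm := SigmaFinite.of_isFiniteMeasureOnCompacts _
  haveI : SigmaFinite ((tm.restrict {t : ↥T | (t : G) ∈ R}).withDensity fun t => (D t : ℝ≥0∞)) :=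
    SigmaFinite.withDensity_of_ne_top (ae_of_all _ fun _ => ENNReal.coe_ne_top)
  have hΦm : Measurable Φ := (continuous_conjFamily_and_smul T Φ hΦ).1.measurable
  have hDm' : Measurable fun t : ↥T => (D t : ℝ≥0∞) := hD.coe_nnreal_ennreal
  have hmain' : ∀ f : G → ℝ≥0∞, Measurable f →
      ((T.subgroupOf (Subgroup.normalizer (T : Set G))).index : ℝ≥0∞) * ∫⁻ y in {x | ∃ g t : G, t ∈ T ∧ t ∈ R ∧ g * t * g⁻¹ = x}, f y ∂ν =
        ∫⁻ t, ∫⁻ q, f (Φ (q, t)) ∂(quotientMeasure T tm hT ν) ∂((tm.restrict {t : ↥T | (t : G) ∈ R}).withDensity fun t => (D t : ℝ≥0∞)) := by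
    intro f hf
    have hOm : Measurable fun t : ↥T => ∫⁻ q, f (Φ (q, t)) ∂(quotientMeasure T tm hT ν) :=
      Measurable.lintegral_prod_left' (μ := (quotientMeasure T tm hT ν)) (hf.comp hΦm)
    rw [hmain f hf, lintegral_withDensity_eq_lintegral_mul _ hDm' hOm]
    rfl
  obtain ⟨hint, heq⟩ := integrable_and_integral_eq_smul_of_lintegral_radial hΦm hmain' g hg
  refine ⟨hint, ?_⟩
  rw [← heq, integral_withDensity_eq_integral_smul hD]
  rfl

end Generic

/-! ## §3 The endoscopic group `H_v = U(Φ₂)(L⁺_v) × U(Φ₁)(L⁺_v)`, `R = {G-regular}`, Cartan `T = Z_H(γ₀)`: the (S-jac) letter of (H5), socket and (H3a)(H3b) by shape -/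

section Endoscopic

variable {L : Type} [Field L] [NumberField L] [IsCMField L] {v : HeightOneSpectrum (𝓞 ↥(maximalRealSubfield L))}
  {T : Subgroup (((UnitaryGroup.cmDatum L 2 (Matrix.of fun i j : Fin 2 => if i.val + j.val + 1 = 2 then (1 : L) else 0)).Local v ×
    (UnitaryGroup.cmDatum L 1 (Matrix.of fun i j : Fin 1 => if i.val + j.val + 1 = 1 then (1 : L) else 0)).Local v))}
  {γ₀ : ((UnitaryGroup.cmDatum L 2 (Matrix.of fun i j : Fin 2 => if i.val + j.val + 1 = 2 then (1 : L) else 0)).Local v ×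
    (UnitaryGroup.cmDatum L 1 (Matrix.of fun i j : Fin 1 => if i.val + j.val + 1 = 1 then (1 : L) else 0)).Local v)}
  (hT : T = Subgroup.centralizer ({γ₀} : Set _))

include hT in
/-- `T = Z_H(γ₀)` is closed (Mathlib `Set.isClosed_centralizer`) — the closedness witness fed to ★ `quotientMeasure` in the heads below (any other witness gives the same measure,
by proof irrelevance). [cite: Rogawski1990, §3.1 p. 19] -/
theorem isClosed_cartanH : IsClosed (T : Set (((UnitaryGroup.cmDatum L 2 (Matrix.of fun i j : Fin 2 => if i.val + j.val + 1 = 2 then (1 : L) else 0)).Local v ×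
    (UnitaryGroup.cmDatum L 1 (Matrix.of fun i j : Fin 1 => if i.val + j.val + 1 = 1 then (1 : L) else 0)).Local v))) := by
  rw [hT]; exact Set.isClosed_centralizer _

variable
  -- (H3b) ∕ (H3a) letters by shape
  (hRc : ∀ g s : ((UnitaryGroup.cmDatum L 2 (Matrix.of fun i j : Fin 2 => if i.val + j.val + 1 = 2 then (1 : L) else 0)).Local v ×
      (UnitaryGroup.cmDatum L 1 (Matrix.of fun i j : Fin 1 => if i.val + j.val + 1 = 1 then (1 : L) else 0)).Local v),
    IsLocalGRegular L v s → IsLocalGRegular L v (g * s * g⁻¹))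
  (hRo : IsOpen {s : ((UnitaryGroup.cmDatum L 2 (Matrix.of fun i j : Fin 2 => if i.val + j.val + 1 = 2 then (1 : L) else 0)).Local v ×
      (UnitaryGroup.cmDatum L 1 (Matrix.of fun i j : Fin 1 => if i.val + j.val + 1 = 1 then (1 : L) else 0)).Local v) | IsLocalGRegular L v s})
  (hab : ∀ a ∈ T, ∀ b ∈ T, a * b = b * a)
  (hZ : ∀ t : ↥T, IsLocalGRegular L v (t : ((UnitaryGroup.cmDatum L 2 (Matrix.of fun i j : Fin 2 => if i.val + j.val + 1 = 2 then (1 : L) else 0)).Local v ×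
      (UnitaryGroup.cmDatum L 1 (Matrix.of fun i j : Fin 1 => if i.val + j.val + 1 = 1 then (1 : L) else 0)).Local v)) →
    Subgroup.centralizer ({(t : ((UnitaryGroup.cmDatum L 2 (Matrix.of fun i j : Fin 2 => if i.val + j.val + 1 = 2 then (1 : L) else 0)).Local v ×
      (UnitaryGroup.cmDatum L 1 (Matrix.of fun i j : Fin 1 => if i.val + j.val + 1 = 1 then (1 : L) else 0)).Local v))} : Set _) = T)
  (hW : (T.subgroupOf (Subgroup.normalizer (T : Set (((UnitaryGroup.cmDatum L 2 (Matrix.of fun i j : Fin 2 => if i.val + j.val + 1 = 2 then (1 : L) else 0)).Local v ×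
      (UnitaryGroup.cmDatum L 1 (Matrix.of fun i j : Fin 1 => if i.val + j.val + 1 = 1 then (1 : L) else 0)).Local v))))).index ≠ 0)
  (Φ : ((((UnitaryGroup.cmDatum L 2 (Matrix.of fun i j : Fin 2 => if i.val + j.val + 1 = 2 then (1 : L) else 0)).Local v ×
      (UnitaryGroup.cmDatum L 1 (Matrix.of fun i j : Fin 1 => if i.val + j.val + 1 = 1 then (1 : L) else 0)).Local v)) ⧸ T) × ↥T →
    ((UnitaryGroup.cmDatum L 2 (Matrix.of fun i j : Fin 2 => if i.val + j.val + 1 = 2 then (1 : L) else 0)).Local v ×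
      (UnitaryGroup.cmDatum L 1 (Matrix.of fun i j : Fin 1 => if i.val + j.val + 1 = 1 then (1 : L) else 0)).Local v))
  (hΦ : ∀ (x : ((UnitaryGroup.cmDatum L 2 (Matrix.of fun i j : Fin 2 => if i.val + j.val + 1 = 2 then (1 : L) else 0)).Local v ×
      (UnitaryGroup.cmDatum L 1 (Matrix.of fun i j : Fin 1 => if i.val + j.val + 1 = 1 then (1 : L) else 0)).Local v)) (t : ↥T),
    Φ (QuotientGroup.mk x, t) = x * t * x⁻¹)
  [MeasurableSpace (((UnitaryGroup.cmDatum L 2 (Matrix.of fun i j : Fin 2 => if i.val + j.val + 1 = 2 then (1 : L) else 0)).Local v ×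
    (UnitaryGroup.cmDatum L 1 (Matrix.of fun i j : Fin 1 => if i.val + j.val + 1 = 1 then (1 : L) else 0)).Local v))]
  [BorelSpace (((UnitaryGroup.cmDatum L 2 (Matrix.of fun i j : Fin 2 => if i.val + j.val + 1 = 2 then (1 : L) else 0)).Local v ×
    (UnitaryGroup.cmDatum L 1 (Matrix.of fun i j : Fin 1 => if i.val + j.val + 1 = 1 then (1 : L) else 0)).Local v))]
  [LocallyCompactSpace (((UnitaryGroup.cmDatum L 2 (Matrix.of fun i j : Fin 2 => if i.val + j.val + 1 = 2 then (1 : L) else 0)).Local v ×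
    (UnitaryGroup.cmDatum L 1 (Matrix.of fun i j : Fin 1 => if i.val + j.val + 1 = 1 then (1 : L) else 0)).Local v))]
  [SecondCountableTopology (((UnitaryGroup.cmDatum L 2 (Matrix.of fun i j : Fin 2 => if i.val + j.val + 1 = 2 then (1 : L) else 0)).Local v ×
    (UnitaryGroup.cmDatum L 1 (Matrix.of fun i j : Fin 1 => if i.val + j.val + 1 = 1 then (1 : L) else 0)).Local v))]
  [T2Space (((UnitaryGroup.cmDatum L 2 (Matrix.of fun i j : Fin 2 => if i.val + j.val + 1 = 2 then (1 : L) else 0)).Local v ×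
    (UnitaryGroup.cmDatum L 1 (Matrix.of fun i j : Fin 1 => if i.val + j.val + 1 = 1 then (1 : L) else 0)).Local v))]
  [MeasurableSpace ((((UnitaryGroup.cmDatum L 2 (Matrix.of fun i j : Fin 2 => if i.val + j.val + 1 = 2 then (1 : L) else 0)).Local v ×
    (UnitaryGroup.cmDatum L 1 (Matrix.of fun i j : Fin 1 => if i.val + j.val + 1 = 1 then (1 : L) else 0)).Local v)) ⧸ T)]
  [BorelSpace ((((UnitaryGroup.cmDatum L 2 (Matrix.of fun i j : Fin 2 => if i.val + j.val + 1 = 2 then (1 : L) else 0)).Local v ×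
    (UnitaryGroup.cmDatum L 1 (Matrix.of fun i j : Fin 1 => if i.val + j.val + 1 = 1 then (1 : L) else 0)).Local v)) ⧸ T)]
  (νHv : Measure (((UnitaryGroup.cmDatum L 2 (Matrix.of fun i j : Fin 2 => if i.val + j.val + 1 = 2 then (1 : L) else 0)).Local v ×
    (UnitaryGroup.cmDatum L 1 (Matrix.of fun i j : Fin 1 => if i.val + j.val + 1 = 1 then (1 : L) else 0)).Local v))) [νHv.IsHaarMeasure] [νHv.IsMulRightInvariant]
  (tT : Measure ↥T) [tT.IsMulLeftInvariant] [IsFiniteMeasureOnCompacts tT] [tT.IsOpenPosMeasure] [tT.IsInvInvariant]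
  (D : ↥T → ℝ≥0) (hD : Measurable D)

set_option maxHeartbeats 1600000 in
-- instance-term unification on the CM local carrier, as ★ (E1b)
include hRc hRo hab hZ hW hΦ hD in
/-- **(H3e) JAC-BY-SHAPE-H, `∫⁻` form: LOCAL TUBE JACOBIAN AT A CARTAN `T = Z_H(γ₀)` OF `H_v = U(Φ₂)(L⁺_v) × U(Φ₁)(L⁺_v)` ⇒ WEIGHTED WEYL INTEGRATION FORMULA ON THE `T`-REGULAR SET `H_T`**
(`R = {G-regular}`; `νHv` Haar, `tT` Haar on `T`, `μ₀ = νHv∕tT`, `D : T → ℝ≥0` any measurable weight — the road's `dh²` or the (H4s)∕(H4c) socket's): under `hJacLoc`,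
`[N_H(T):T] · ∫⁻_{H_T} f dνHv = ∫⁻_{t ∈ T, G-regular} D(t) · ∫⁻_{H_v⧸T} f(Φ(q,t)) dμ₀ dtT` for every Borel `f ≥ 0` (§1 at `H_v`, (H3a)(H3b) letters by shape).
[cite: Rogawski1990, §12.5 pp. 182–183, Lemma 12.5.1] [cite: HarishChandra1970, Lemma 20; Lemma 22; Lemma 42] -/
theorem lintegral_cartanSetH_eq_of_tubeJacobian_local
    (hJacLoc : ∀ t₀ : ↥T, IsLocalGRegular L v (t₀ : ((UnitaryGroup.cmDatum L 2 (Matrix.of fun i j : Fin 2 => if i.val + j.val + 1 = 2 then (1 : L) else 0)).Local v ×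
        (UnitaryGroup.cmDatum L 1 (Matrix.of fun i j : Fin 1 => if i.val + j.val + 1 = 1 then (1 : L) else 0)).Local v)) →
      ∃ U : Set ↥T, IsOpen U ∧ t₀ ∈ U ∧
        ∃ A₀ : Set ((((UnitaryGroup.cmDatum L 2 (Matrix.of fun i j : Fin 2 => if i.val + j.val + 1 = 2 then (1 : L) else 0)).Local v ×
            (UnitaryGroup.cmDatum L 1 (Matrix.of fun i j : Fin 1 => if i.val + j.val + 1 = 1 then (1 : L) else 0)).Local v)) ⧸ T),
          MeasurableSet A₀ ∧ (quotientMeasure T tT (isClosed_cartanH hT) νHv) A₀ ≠ 0 ∧ (quotientMeasure T tT (isClosed_cartanH hT) νHv) A₀ ≠ ∞ ∧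
          ∀ V : Set ↥T, MeasurableSet V → V ⊆ U →
            (∀ t ∈ V, IsLocalGRegular L v (t : ((UnitaryGroup.cmDatum L 2 (Matrix.of fun i j : Fin 2 => if i.val + j.val + 1 = 2 then (1 : L) else 0)).Local v ×
              (UnitaryGroup.cmDatum L 1 (Matrix.of fun i j : Fin 1 => if i.val + j.val + 1 = 1 then (1 : L) else 0)).Local v))) →
            (∀ n : ((UnitaryGroup.cmDatum L 2 (Matrix.of fun i j : Fin 2 => if i.val + j.val + 1 = 2 then (1 : L) else 0)).Local v ×
              (UnitaryGroup.cmDatum L 1 (Matrix.of fun i j : Fin 1 => if i.val + j.val + 1 = 1 then (1 : L) else 0)).Local v),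
              n ∉ T → ∀ t ∈ V, ∀ t' ∈ V, ((t' : ↥T) : ((UnitaryGroup.cmDatum L 2 (Matrix.of fun i j : Fin 2 => if i.val + j.val + 1 = 2 then (1 : L) else 0)).Local v ×
                (UnitaryGroup.cmDatum L 1 (Matrix.of fun i j : Fin 1 => if i.val + j.val + 1 = 1 then (1 : L) else 0)).Local v)) ≠ n * t * n⁻¹) →
              νHv (Φ '' (A₀ ×ˢ V)) = (quotientMeasure T tT (isClosed_cartanH hT) νHv) A₀ * ∫⁻ t in V, (D t : ℝ≥0∞) ∂tT) :
    ∀ f : ((UnitaryGroup.cmDatum L 2 (Matrix.of fun i j : Fin 2 => if i.val + j.val + 1 = 2 then (1 : L) else 0)).Local v ×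
        (UnitaryGroup.cmDatum L 1 (Matrix.of fun i j : Fin 1 => if i.val + j.val + 1 = 1 then (1 : L) else 0)).Local v) → ℝ≥0∞, Measurable f →
      ((T.subgroupOf (Subgroup.normalizer (T : Set _))).index : ℝ≥0∞) *
          ∫⁻ y in {x | ∃ g s : ((UnitaryGroup.cmDatum L 2 (Matrix.of fun i j : Fin 2 => if i.val + j.val + 1 = 2 then (1 : L) else 0)).Local v ×
              (UnitaryGroup.cmDatum L 1 (Matrix.of fun i j : Fin 1 => if i.val + j.val + 1 = 1 then (1 : L) else 0)).Local v),
            s ∈ T ∧ IsLocalGRegular L v s ∧ g * s * g⁻¹ = x}, f y ∂νHv =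
        ∫⁻ t in {t : ↥T | IsLocalGRegular L v (t : ((UnitaryGroup.cmDatum L 2 (Matrix.of fun i j : Fin 2 => if i.val + j.val + 1 = 2 then (1 : L) else 0)).Local v ×
            (UnitaryGroup.cmDatum L 1 (Matrix.of fun i j : Fin 1 => if i.val + j.val + 1 = 1 then (1 : L) else 0)).Local v))},
          (D t : ℝ≥0∞) * ∫⁻ q, f (Φ (q, t)) ∂(quotientMeasure T tT (isClosed_cartanH hT) νHv) ∂tT :=
  lintegral_cartanSet_eq_of_tubeJacobian_local (R := {s | IsLocalGRegular L v s}) hRo.measurableSet (fun g x hx => hRc g x hx) (isClosed_cartanH hT) hab hZ hW Φ hΦ νHv tT D hD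
    hJacLoc

set_option maxHeartbeats 1600000 in
-- instance-term unification on the CM local carrier, as ★ (E1b)
include hRc hRo hab hZ hW hΦ hD in
/-- **(H3e) JAC-BY-SHAPE-H = the (S-jac) letter of (H5) WIF-H, Bochner form**: under the local tube-Jacobian socket `hJacLoc` at the Cartan `T = Z_H(γ₀)` of `H_v` with weight `D`, for
every `g : H_v → ℂ` that is `νHv`-integrable on the `T`-regular set `H_T = {x s x⁻¹ | s ∈ T, s G-regular}`: `(t, q) ↦ g(Φ(q,t))` is `(D · tT|_{T^{G-reg}}) ⊗ (νHv∕tT)`-integrable and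
**`∫_{t ∈ T, G-regular} D(t) • (∫_{H_v⧸T} g(Φ(q,t)) d(νHv∕tT)) dtT = [N_H(T):T] • ∫_{H_T} g dνHv`** (§2 at `H_v`). [cite: Rogawski1990, §12.5 pp. 182–183, Lemma 12.5.1]
[cite: HarishChandra1970, Lemma 42] -/
theorem integral_cartanSetH_eq_of_tubeJacobian_local
    (hJacLoc : ∀ t₀ : ↥T, IsLocalGRegular L v (t₀ : ((UnitaryGroup.cmDatum L 2 (Matrix.of fun i j : Fin 2 => if i.val + j.val + 1 = 2 then (1 : L) else 0)).Local v ×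
        (UnitaryGroup.cmDatum L 1 (Matrix.of fun i j : Fin 1 => if i.val + j.val + 1 = 1 then (1 : L) else 0)).Local v)) →
      ∃ U : Set ↥T, IsOpen U ∧ t₀ ∈ U ∧
        ∃ A₀ : Set ((((UnitaryGroup.cmDatum L 2 (Matrix.of fun i j : Fin 2 => if i.val + j.val + 1 = 2 then (1 : L) else 0)).Local v ×
            (UnitaryGroup.cmDatum L 1 (Matrix.of fun i j : Fin 1 => if i.val + j.val + 1 = 1 then (1 : L) else 0)).Local v)) ⧸ T),
          MeasurableSet A₀ ∧ (quotientMeasure T tT (isClosed_cartanH hT) νHv) A₀ ≠ 0 ∧ (quotientMeasure T tT (isClosed_cartanH hT) νHv) A₀ ≠ ∞ ∧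
          ∀ V : Set ↥T, MeasurableSet V → V ⊆ U →
            (∀ t ∈ V, IsLocalGRegular L v (t : ((UnitaryGroup.cmDatum L 2 (Matrix.of fun i j : Fin 2 => if i.val + j.val + 1 = 2 then (1 : L) else 0)).Local v ×
              (UnitaryGroup.cmDatum L 1 (Matrix.of fun i j : Fin 1 => if i.val + j.val + 1 = 1 then (1 : L) else 0)).Local v))) →
            (∀ n : ((UnitaryGroup.cmDatum L 2 (Matrix.of fun i j : Fin 2 => if i.val + j.val + 1 = 2 then (1 : L) else 0)).Local v ×
              (UnitaryGroup.cmDatum L 1 (Matrix.of fun i j : Fin 1 => if i.val + j.val + 1 = 1 then (1 : L) else 0)).Local v),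
              n ∉ T → ∀ t ∈ V, ∀ t' ∈ V, ((t' : ↥T) : ((UnitaryGroup.cmDatum L 2 (Matrix.of fun i j : Fin 2 => if i.val + j.val + 1 = 2 then (1 : L) else 0)).Local v ×
                (UnitaryGroup.cmDatum L 1 (Matrix.of fun i j : Fin 1 => if i.val + j.val + 1 = 1 then (1 : L) else 0)).Local v)) ≠ n * t * n⁻¹) →
              νHv (Φ '' (A₀ ×ˢ V)) = (quotientMeasure T tT (isClosed_cartanH hT) νHv) A₀ * ∫⁻ t in V, (D t : ℝ≥0∞) ∂tT)
    (g : ((UnitaryGroup.cmDatum L 2 (Matrix.of fun i j : Fin 2 => if i.val + j.val + 1 = 2 then (1 : L) else 0)).Local v ×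
        (UnitaryGroup.cmDatum L 1 (Matrix.of fun i j : Fin 1 => if i.val + j.val + 1 = 1 then (1 : L) else 0)).Local v) → ℂ)
    (hg : IntegrableOn g {x | ∃ g s : ((UnitaryGroup.cmDatum L 2 (Matrix.of fun i j : Fin 2 => if i.val + j.val + 1 = 2 then (1 : L) else 0)).Local v ×
        (UnitaryGroup.cmDatum L 1 (Matrix.of fun i j : Fin 1 => if i.val + j.val + 1 = 1 then (1 : L) else 0)).Local v),
      s ∈ T ∧ IsLocalGRegular L v s ∧ g * s * g⁻¹ = x} νHv) :
    Integrable (fun p : ↥T × ((((UnitaryGroup.cmDatum L 2 (Matrix.of fun i j : Fin 2 => if i.val + j.val + 1 = 2 then (1 : L) else 0)).Local v ×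
          (UnitaryGroup.cmDatum L 1 (Matrix.of fun i j : Fin 1 => if i.val + j.val + 1 = 1 then (1 : L) else 0)).Local v)) ⧸ T) => g (Φ (p.2, p.1)))
        (((tT.restrict {t : ↥T | IsLocalGRegular L v (t : ((UnitaryGroup.cmDatum L 2 (Matrix.of fun i j : Fin 2 => if i.val + j.val + 1 = 2 then (1 : L) else 0)).Local v ×
            (UnitaryGroup.cmDatum L 1 (Matrix.of fun i j : Fin 1 => if i.val + j.val + 1 = 1 then (1 : L) else 0)).Local v))}).withDensity fun t => (D t : ℝ≥0∞)).prod
          (quotientMeasure T tT (isClosed_cartanH hT) νHv)) ∧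
      ∫ t in {t : ↥T | IsLocalGRegular L v (t : ((UnitaryGroup.cmDatum L 2 (Matrix.of fun i j : Fin 2 => if i.val + j.val + 1 = 2 then (1 : L) else 0)).Local v ×
            (UnitaryGroup.cmDatum L 1 (Matrix.of fun i j : Fin 1 => if i.val + j.val + 1 = 1 then (1 : L) else 0)).Local v))},
          (D t : ℝ) • ∫ q, g (Φ (q, t)) ∂(quotientMeasure T tT (isClosed_cartanH hT) νHv) ∂tT =
        ((T.subgroupOf (Subgroup.normalizer (T : Set _))).index : ℝ) •
          ∫ y in {x | ∃ g s : ((UnitaryGroup.cmDatum L 2 (Matrix.of fun i j : Fin 2 => if i.val + j.val + 1 = 2 then (1 : L) else 0)).Local v ×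
              (UnitaryGroup.cmDatum L 1 (Matrix.of fun i j : Fin 1 => if i.val + j.val + 1 = 1 then (1 : L) else 0)).Local v),
            s ∈ T ∧ IsLocalGRegular L v s ∧ g * s * g⁻¹ = x}, g y ∂νHv :=
  integral_cartanSet_eq_of_tubeJacobian_local (R := {s | IsLocalGRegular L v s}) hRo.measurableSet (fun g x hx => hRc g x hx) (isClosed_cartanH hT) hab hZ hW Φ hΦ νHv tT D hD
    hJacLoc g hg

set_option maxHeartbeats 1600000 in
-- instance-term unification on the CM local carrier, as ★ (E1b)
include hRc hRo hab hZ hW hΦ hD in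
/-- **(S-jac), equation only** (the second component of `integral_cartanSetH_eq_of_tubeJacobian_local`, in the exact shape of the (H5) assembler's `hJacInt` letter):
`IntegrableOn g H_T νHv → ∫_{t ∈ T, G-regular} D(t) • ∫_{H_v⧸T} g(Φ(q,t)) d(νHv∕tT) dtT = [N_H(T):T] • ∫_{H_T} g dνHv`. [cite: Rogawski1990, §12.5 pp. 182–183, Lemma 12.5.1] [cite: HarishChandra1970, Lemma 42] -/
theorem setIntegral_weighted_orbital_eq_smul_setIntegral_cartanSetH
    (hJacLoc : ∀ t₀ : ↥T, IsLocalGRegular L v (t₀ : ((UnitaryGroup.cmDatum L 2 (Matrix.of fun i j : Fin 2 => if i.val + j.val + 1 = 2 then (1 : L) else 0)).Local v ×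
        (UnitaryGroup.cmDatum L 1 (Matrix.of fun i j : Fin 1 => if i.val + j.val + 1 = 1 then (1 : L) else 0)).Local v)) →
      ∃ U : Set ↥T, IsOpen U ∧ t₀ ∈ U ∧
        ∃ A₀ : Set ((((UnitaryGroup.cmDatum L 2 (Matrix.of fun i j : Fin 2 => if i.val + j.val + 1 = 2 then (1 : L) else 0)).Local v ×
            (UnitaryGroup.cmDatum L 1 (Matrix.of fun i j : Fin 1 => if i.val + j.val + 1 = 1 then (1 : L) else 0)).Local v)) ⧸ T),
          MeasurableSet A₀ ∧ (quotientMeasure T tT (isClosed_cartanH hT) νHv) A₀ ≠ 0 ∧ (quotientMeasure T tT (isClosed_cartanH hT) νHv) A₀ ≠ ∞ ∧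
          ∀ V : Set ↥T, MeasurableSet V → V ⊆ U →
            (∀ t ∈ V, IsLocalGRegular L v (t : ((UnitaryGroup.cmDatum L 2 (Matrix.of fun i j : Fin 2 => if i.val + j.val + 1 = 2 then (1 : L) else 0)).Local v ×
              (UnitaryGroup.cmDatum L 1 (Matrix.of fun i j : Fin 1 => if i.val + j.val + 1 = 1 then (1 : L) else 0)).Local v))) →
            (∀ n : ((UnitaryGroup.cmDatum L 2 (Matrix.of fun i j : Fin 2 => if i.val + j.val + 1 = 2 then (1 : L) else 0)).Local v ×
              (UnitaryGroup.cmDatum L 1 (Matrix.of fun i j : Fin 1 => if i.val + j.val + 1 = 1 then (1 : L) else 0)).Local v),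
              n ∉ T → ∀ t ∈ V, ∀ t' ∈ V, ((t' : ↥T) : ((UnitaryGroup.cmDatum L 2 (Matrix.of fun i j : Fin 2 => if i.val + j.val + 1 = 2 then (1 : L) else 0)).Local v ×
                (UnitaryGroup.cmDatum L 1 (Matrix.of fun i j : Fin 1 => if i.val + j.val + 1 = 1 then (1 : L) else 0)).Local v)) ≠ n * t * n⁻¹) →
              νHv (Φ '' (A₀ ×ˢ V)) = (quotientMeasure T tT (isClosed_cartanH hT) νHv) A₀ * ∫⁻ t in V, (D t : ℝ≥0∞) ∂tT)
    (g : ((UnitaryGroup.cmDatum L 2 (Matrix.of fun i j : Fin 2 => if i.val + j.val + 1 = 2 then (1 : L) else 0)).Local v ×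
        (UnitaryGroup.cmDatum L 1 (Matrix.of fun i j : Fin 1 => if i.val + j.val + 1 = 1 then (1 : L) else 0)).Local v) → ℂ)
    (hg : IntegrableOn g {x | ∃ g s : ((UnitaryGroup.cmDatum L 2 (Matrix.of fun i j : Fin 2 => if i.val + j.val + 1 = 2 then (1 : L) else 0)).Local v ×
        (UnitaryGroup.cmDatum L 1 (Matrix.of fun i j : Fin 1 => if i.val + j.val + 1 = 1 then (1 : L) else 0)).Local v),
      s ∈ T ∧ IsLocalGRegular L v s ∧ g * s * g⁻¹ = x} νHv) :
    ∫ t in {t : ↥T | IsLocalGRegular L v (t : ((UnitaryGroup.cmDatum L 2 (Matrix.of fun i j : Fin 2 => if i.val + j.val + 1 = 2 then (1 : L) else 0)).Local v ×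
        (UnitaryGroup.cmDatum L 1 (Matrix.of fun i j : Fin 1 => if i.val + j.val + 1 = 1 then (1 : L) else 0)).Local v))},
        (D t : ℝ) • ∫ q, g (Φ (q, t)) ∂(quotientMeasure T tT (isClosed_cartanH hT) νHv) ∂tT =
      ((T.subgroupOf (Subgroup.normalizer (T : Set _))).index : ℝ) •
        ∫ y in {x | ∃ g s : ((UnitaryGroup.cmDatum L 2 (Matrix.of fun i j : Fin 2 => if i.val + j.val + 1 = 2 then (1 : L) else 0)).Local v ×
        (UnitaryGroup.cmDatum L 1 (Matrix.of fun i j : Fin 1 => if i.val + j.val + 1 = 1 then (1 : L) else 0)).Local v),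
          s ∈ T ∧ IsLocalGRegular L v s ∧ g * s * g⁻¹ = x}, g y ∂νHv :=
  (integral_cartanSetH_eq_of_tubeJacobian_local hT hRc hRo hab hZ hW Φ hΦ νHv tT D hD hJacLoc g hg).2

end Endoscopic

end Summit.HodgeConjecture.HodgeConjecture.Cruxes.H413.F0P3cStCharTSUpTrJacobian
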